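import Literature.NumberTheory.Transcendental.ZilberFieldExistenceProofs
import Literature.NumberTheory.Transcendental.GammaFieldsEcl
import Literature.NumberTheory.Transcendental.EclClosureOperatorProofs
import HarnessLib

/-!
# `ecl`-closed E-subfields of Zilber fields: the elementary axioms

B. Zilber, *Pseudo-exponentiation on algebraically closed fields of characteristic zero*, Ann.
Pure Appl. Logic 132 (2005), §5 (Lemma 5.2 ff.: `ecl`-closed substructures of members of the
class are members); M. Bays, J. Kirby, arXiv:1305.0493 (2013), Prop. 4 (Kirby's axiom I.2 for
`ECF_{SK,CCP}`: "if `H ∈ 𝒞` and `X ⊆ H` then `cl_H(X) ∈ 𝒞`"); M. Bays, J. Kirby, Algebra & Number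
Theory 12 (2018), proof of Thm 8.2 ("If `F₀` is a finite-dimensional substructure of `F` then `F₀`
satisfies axioms 1–3 and 5 immediately and, using Lemma 8.3, also axiom 4").

For a Zilber field `K` and `X ⊆ K`, the `ecl`-closed E-subfield `E = ecl X`
(`Khovanskii.eclSubfield X`) satisfies "immediately" five of the six axioms of `IsZilberField`:

* `Khovanskii.eclSubfield.isAlgClosed` — `E` is algebraically closed (relatively algebraically
  closed in the algebraically closed `K`: Kirby 2010 (EAEF), proof of Prop. 7.1,
  `Kirby2010_ecl_relAlgClosed_holds`);
* `Khovanskii.eclSubfield.hasStandardKernel` — the kernel is still `τℤ` (`τ ∈ ecl ∅`);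
* `Khovanskii.eclSubfield.isSurjectiveOntoUnits` — logarithms of elements of `ecl X` lie in
  `ecl X` (`mem_ecl_of_exp_mem`);
* `Khovanskii.eclSubfield.schanuelProperty` — the Schanuel property passes to E-subfields
  (`SchanuelProperty.of_injective_holds`);
* `Khovanskii.eclSubfield.countable_ecl` — the countable closure property (`ecl` is computed
  inside `ecl X`, `Khovanskii.eclSubfield.image_ecl`);

and `IsZilberField.eclSubfield_of_isLinIndepExpAlgClosed` assembles `IsZilberField (ecl X)` from
these granted the sixth, strong exponential-algebraic closedness of `ecl X` in Kirby's
linear-independence form (`IsLinIndepExpAlgClosed`, equivalent by Kirby 2013 §2.3,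
`IsZilberField.of_thm91_axioms`) — the "SGClosed lemma" part of the source, treated separately.
Everything here is proved.

## References

* B. Zilber, Ann. Pure Appl. Logic 132 (2005) 67–95: §5.
* M. Bays, J. Kirby, arXiv:1305.0493 (2013): Prop. 4.
* M. Bays, J. Kirby, Algebra & Number Theory 12 (2018) 493–549: Thm 8.2 (proof), Lemma 8.3.
* J. Kirby, *Exponential algebraicity in exponential fields*, Bull. LMS 42 (2010): Lemma 3.3,
  Prop. 7.1 (proof).
-/

noncomputable section

open Set

namespace Literature.NumberTheory.Transcendental

open Literature.ModelTheory.ExponentialFields Literature.ModelTheory.ExponentialFields.ExponentialRing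

namespace Khovanskii.eclSubfield

variable {K : Type*} [Field K] [CharZero K] [ExponentialRing K]

/-- **`ecl X` is algebraically closed** when `K` is: a polynomial over `ecl X` has a root in `K`,
which is algebraic over `ecl X`, hence in `ecl X` (Kirby 2010 (EAEF), proof of Prop. 7.1: `ecl C`
is relatively algebraically closed). [cite: Kirby2010, §7 (proof of Prop. 7.1)] -/
theorem isAlgClosed [IsAlgClosed K] (X : Set K) : IsAlgClosed (Khovanskii.eclSubfield X) := by
  refine IsAlgClosed.of_exists_root _ fun p hp hirr => ?_
  have hdeg : (p.map (algebraMap (Khovanskii.eclSubfield X) K)).degree ≠ 0 := by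
    rw [Polynomial.degree_map]
    exact (Polynomial.degree_pos_of_irreducible hirr).ne'
  obtain ⟨a, ha⟩ := IsAlgClosed.exists_root (p.map (algebraMap (Khovanskii.eclSubfield X) K)) hdeg
  have hne : p.map (algebraMap (Khovanskii.eclSubfield X) K) ≠ 0 := Polynomial.map_monic_ne_zero hp
  have hcoeff : ∀ i, (p.map (algebraMap (Khovanskii.eclSubfield X) K)).coeff i ∈ ecl X := fun i => by
    rw [Polynomial.coeff_map]
    exact (p.coeff i).2
  have haE : a ∈ ecl X := Kirby2010_ecl_relAlgClosed_holds K X a _ hne hcoeff ha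
  refine ⟨⟨a, haE⟩, ?_⟩
  apply (algebraMap (Khovanskii.eclSubfield X) K).injective
  rw [map_zero, ← Polynomial.eval₂_hom, ← Polynomial.eval_map]
  exact ha

/-- **The kernel of `exp` on `ecl X` is still standard**: `τ ∈ ecl X` (kernel elements are
exponentially algebraic) and `τ` stays transcendental. [cite: Kirby2010, Lemma 3.3] -/
theorem hasStandardKernel (hker : HasStandardKernel K) (X : Set K) :
    HasStandardKernel (Khovanskii.eclSubfield X) := by
  obtain ⟨τ, hτ, hker⟩ := hker
  let E := Khovanskii.eclSubfield X
  have hτE : τ ∈ ecl X :=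
    GammaField.expKernel_subset_ecl X (by rw [hker]; exact AddSubgroup.mem_zmultiples τ)
  refine ⟨⟨τ, hτE⟩, ?_, ?_⟩
  · have : Transcendental ℚ (algebraMap E K ⟨τ, hτE⟩) := hτ
    exact (transcendental_algebraMap_iff (algebraMap E K).injective).1 this
  · ext x
    rw [mem_expKernel_iff, AddSubgroup.mem_zmultiples_iff]
    have hK : (ExponentialRing.exp (x : K) = 1) ↔ (x : K) ∈ expKernel K := (mem_expKernel_iff _).symm
    constructor
    · intro hx
      have hx' : ExponentialRing.exp (x : K) = 1 := by
        have := congr_arg Subtype.val hx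
        simpa using this
      rw [hK, hker, AddSubgroup.mem_zmultiples_iff] at hx'
      obtain ⟨n, hn⟩ := hx'
      exact ⟨n, Subtype.ext (by simpa using hn)⟩
    · rintro ⟨n, rfl⟩
      apply Subtype.ext
      have h1 : ExponentialRing.exp ((n • (⟨τ, hτE⟩ : E) : E) : K) = 1 := by
        rw [hK, hker]
        simp only [AddSubgroupClass.coe_zsmul]
        exact AddSubgroup.zsmul_mem_zmultiples τ n
      simpa using h1

omit [CharZero K] in
/-- **`exp` maps `ecl X` onto its units**: a logarithm of an element of `ecl X` lies in `ecl X`.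
[cite: Kirby2010, Lemma 3.3] -/
theorem isSurjectiveOntoUnits (hsurj : IsSurjectiveOntoUnits K) (X : Set K) :
    IsSurjectiveOntoUnits (Khovanskii.eclSubfield X) := by
  intro y hy
  have hy' : (y : K) ≠ 0 := fun h => hy (Subtype.ext h)
  obtain ⟨x, hx⟩ := hsurj (y : K) hy'
  have hxE : x ∈ ecl X := GammaField.mem_ecl_of_exp_mem (by rw [hx]; exact y.2)
  exact ⟨⟨x, hxE⟩, Subtype.ext hx⟩

/-- **The Schanuel property passes to `ecl X`** (an E-subfield).
[cite: Kirby2013, §2] -/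
theorem schanuelProperty (hSP : SchanuelProperty K) (X : Set K) :
    SchanuelProperty (Khovanskii.eclSubfield X) :=
  SchanuelProperty.of_injective_holds (Khovanskii.eclSubfield.eHom X) hSP

omit [CharZero K] in
/-- **Countable closure inside `ecl X`**: `ecl` computed in the E-field `ecl X` is `ecl` computed
in `K` (`Khovanskii.eclSubfield.image_ecl`), hence countable for countable parameter sets.
[cite: BaysKirby2018ANT, Thm 9.1 (axiom 5)] -/
theorem countable_ecl (hccp : HasCountableClosureProperty K) (X : Set K)
    {A : Set (Khovanskii.eclSubfield X)} (hA : A.Countable) : (ecl A).Countable := by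
  have h1 : (Subtype.val '' ecl A).Countable := by
    rw [Khovanskii.eclSubfield.image_ecl]
    exact hccp _ (hA.image _)
  exact Set.countable_of_injective_of_countable_image Subtype.val_injective.injOn h1

end Khovanskii.eclSubfield

/-- **`ecl`-closed E-subfields of Zilber fields are Zilber fields, granted their strong
exponential-algebraic closedness** (Zilber 2005 §5; Bays–Kirby 2013, Prop. 4 = Kirby's axiom I.2;
Bays–Kirby 2018, proof of Thm 8.2): algebraic closedness, standard kernel, surjectivity of `exp`,
the Schanuel property and the countable closure property of `ecl X` are the lemmas above; the
remaining axiom is taken in Kirby's linear-independence form and converted by Kirby 2013, §2.3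
(`IsZilberField.of_thm91_axioms`). [cite: BaysKirby2013Excellence, Prop. 4 (axiom I.2)]
[cite: BaysKirby2018ANT, Thm 8.2 (proof)] -/
theorem IsZilberField.eclSubfield_of_isLinIndepExpAlgClosed {K : Type*} [Field K] [CharZero K]
    [ExponentialRing K] (hK : IsZilberField K) (X : Set K)
    (hLI : IsLinIndepExpAlgClosed (Khovanskii.eclSubfield X)) :
    IsZilberField (Khovanskii.eclSubfield X) :=
  haveI := hK.isAlgClosed
  IsZilberField.of_thm91_axioms (Khovanskii.eclSubfield.isAlgClosed X)
    (Khovanskii.eclSubfield.isSurjectiveOntoUnits hK.isSurjectiveOntoUnits X)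
    (Khovanskii.eclSubfield.hasStandardKernel hK.hasStandardKernel X)
    (Khovanskii.eclSubfield.schanuelProperty hK.schanuelProperty X) hLI
    (fun _ hA => Khovanskii.eclSubfield.countable_ecl hK.hasCountableClosureProperty X hA.countable)

end Literature.NumberTheory.Transcendental

end
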